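import Literature.NumberTheory.Automorphic.AutomorphicRepsGL2WeightOneNewvector
import Literature.NumberTheory.Automorphic.StrongArtinCentralCharacter
import Literature.NumberTheory.Automorphic.LanglandsTunnellDeligneSerreAssembly
import Literature.NumberTheory.Automorphic.DeligneSerreThm46aHolds
import HarnessLib

/-!
# Gelbart's Prop. 4.2 (`exists_isNewform1_of_isPiOfArtinRep`) from Deligne–Serre Thm. 4.1, the
# archimedean input (weight one / parameter pair), and the existence of a `K₁`-fixed vector

Topic `NumberTheory/Automorphic`; an assembly (theorems only: no definition, no named fact).
The named fact `exists_isNewform1_of_isPiOfArtinRep` (`StrongArtinGL2`, Gelbart 1997, Prop. 4.2: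
the weight-one newform of `π(σ)` for an odd irreducible `σ : Γ_ℚ → GL₂(ℂ)`) was reduced in
`StrongArtinGL2WeightOneDictionary` / `LanglandsTunnellDeligneSerreAssembly`
(`exists_isNewform1_of_isPiOfArtinRep_of_dictionary_of_deligneSerre`) to Deligne–Serre's Thm. 4.1
and Thm. 4.6 (a) (`hDS`, `hDSa`) and two hypotheses on the automorphic side: `harch` ("`π(σ)` is
of weight one") and `hdesc` (the weight-one dictionary `π ↦ f_π` with its Satake clause). With the
tree as it now stands:

* `hDSa` is the theorem `artinConductorNat_eq_level_holds` (`DeligneSerreThm46aHolds`);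
* `harch` ⟸ **`hpair`: the archimedean Harish-Chandra parameter of `π(σ)` is a pair `{s, s}`** —
  everything else in "`π_∞ = π(1, sgn)`" is proved in `StrongArtinCentralCharacter`
  (`IsPiOfArtinRep.isOfWeightOne_of_hasArchParameter_pair`: the central character of `π(σ)` is the
  finite-order reciprocity character of `det σ`, so `s + s = 0`, and, `σ` being odd, `-1_∞` acts by
  `-1`); what `hpair` retains is Gelbart's Prop. 4.1 at the archimedean place (`π_∞ = π(σ_∞)` from
  `π_v = π(σ_v)` for almost all finite `v`: the exclusion of `π_∞ = π(|·|^{s}, |·|^{-s} sgn)`, `s ≠ 0`,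
  by the archimedean `L`-factors in the functional equations; [La] pp. 23–24);
* `hdesc` ⟸ **`hfix`: a clean cuspidal `π₀ = C / ⊥` of weight one with `A_G`-invariant forms has a
  non-zero vector fixed by `{1} × K₁(N)` for some `N ≥ 1`** — the existence half of Casselman's
  theorem (Casselman 1973, Thm. 1); everything else in Gelbart's Prop. 2.5 (converse) and its
  Corollary is proved: the clean model (`IsOfWeightOne.exists_clean`), the descent of a `K₁(N₀)`-fixed
  weight-one vector at the least level `N₀` and its newform
  (`AutomorphicRepsGL2WeightOneNewvector.IsOfWeightOne.exists_isNewform1_of_exists_fixed`, through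
  `NewformAdelisationAdjointDegeneracy`: the least `K₁`-level is new), and the Satake parameters at
  every `p ∤ N₀` (`AutomorphicRepsGL2WeightOneHeckeEigenform.hasSatakeParamAt_of_adelicLiftFunA_mem`:
  `(X - α)(X - β) = X² - a_p(f) X + ε_f(p)`).

* `exists_isNewform1_of_isPiOfArtinRep_of_isOfWeightOne_of_fixed` — **Gelbart's Prop. 4.2 from
  Deligne–Serre Thm. 4.1, `harch` and the `K₁`-fixed vector `hfix`**;
* `exists_isNewform1_of_isPiOfArtinRep_of_pair_of_fixed` — the same with `harch` replaced by the
  parameter pair `hpair`.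

(The hypothesis `hfix` is discharged in `StrongArtinGL2WeightOnePair` by the new-vector existence
theorem of `GL2NewvectorExistence`.)

## References

* S. Gelbart, *Three lectures on the modularity of `ρ̄_{E,3}` and the Langlands reciprocity
  conjecture* (1997), Prop. 2.5 and Corollary, Prop. 4.1, Prop. 4.2. [Gelbart1997]
* S. Gelbart, *Automorphic forms on adele groups* (1975), Thm. 5.19 and Remark 4.25. [Gelbart1975]
* W. Casselman, *On some results of Atkin and Lehner*, Math. Ann. 201 (1973), Thm. 1. [Casselman1973]
* P. Deligne, J.-P. Serre, *Formes modulaires de poids 1*, Ann. Sci. ÉNS 7 (1974), Thm. 4.1,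
  Thm. 4.6 (a). [DeligneSerreASENS1974]
-/

noncomputable section

open scoped MatrixGroups NumberField Polynomial ModularForm Classical
open NumberField IsDedekindDomain Field Polynomial
open CongruenceSubgroup Rat.HeightOneSpectrum

namespace Literature.NumberTheory.Automorphic

open EllipticCurves.ModularForms

/-- **Gelbart's Prop. 4.2 (`exists_isNewform1_of_isPiOfArtinRep`) from Deligne–Serre's Thm. 4.1
(`hDS`), "`π(σ)` is of weight one for odd irreducible `σ`" (`harch`, the archimedean input of
Gelbart's proof: `π_∞ = π(1, sgn)`) and the existence of a `K₁`-fixed vector (`hfix`: a clean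
cuspidal `π₀ = C / ⊥` of weight one with `A_G`-invariant forms has a non-zero `{1} × K₁(N)`-fixed
vector for some `N ≥ 1`; Casselman 1973, Thm. 1, existence half).** Assembly: `hDSa` is
`artinConductorNat_eq_level_holds`; `hdesc` by `IsOfWeightOne.exists_isNewform1_of_exists_fixed`
(clean model, least `K₁`-level, newform with `φ_f ∈ C`) and
`AutomorphicRepData.hasSatakeParamAt_of_adelicLiftFunA_mem` with the newform identities
`T_p f = a_p(f) f`, `⟨p⟩ f = ε_f(p) f`, so that the Satake polynomial at `p ∤ N₀` is the Hecke
polynomial `X² - a_p(f) X + ε_f(p)` of `f`; then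
`exists_isNewform1_of_isPiOfArtinRep_of_dictionary_of_deligneSerre`.
[cite: Gelbart1997, Prop. 4.2, Prop. 2.5 and Corollary] [cite: Gelbart1975, Thm. 5.19]
[cite: Casselman1973, Thm. 1] [cite: DeligneSerreASENS1974, Thm. 4.1 and Thm. 4.6 (a)] -/
theorem exists_isNewform1_of_isPiOfArtinRep_of_isOfWeightOne_of_fixed
    (hDS : ∀ {N : ℕ} [NeZero N], exists_complexGaloisRep_of_weight_one (N := N))
    (harch : ∀ (hcpt : isCompact_glFiniteIntegralLevel 2 ℚ)
      (σ : GaloisRepresentations.FramedArtinRep ℚ 2) (π : CuspidalAutomorphicRepData 2 ℚ hcpt),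
      σ.toGaloisRep.IsIrreducible → σ.IsOdd → IsPiOfArtinRep σ π.1 → π.1.IsOfWeightOne)
    (hfix : ∀ (hcpt : isCompact_glFiniteIntegralLevel 2 ℚ) (π₀ : CuspidalAutomorphicRepData 2 ℚ hcpt),
      π₀.1.W' = ⊥ → π₀.1.IsOfWeightOne →
        (∀ φ ∈ π₀.1.W, ∀ z ∈ (AdelicGroupData.gl 2 ℚ).center', ∀ g, φ (z * g) = φ g) →
          ∃ (N : ℕ) (_ : NeZero N), ∃ φ ∈ π₀.1.W, φ ≠ 0 ∧
            ∀ u ∈ gammaOneFiniteLevel ℚ (Ideal.span {(N : 𝓞 ℚ)}),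
              rightTranslation (AdelicGroupData.gl 2 ℚ) (GLn.ofFinite 2 ℚ u) φ = φ) :
    exists_isNewform1_of_isPiOfArtinRep :=
  exists_isNewform1_of_isPiOfArtinRep_of_dictionary_of_deligneSerre hDS
    (fun {_} _ {_} {_} => artinConductorNat_eq_level_holds) harch
    (fun hcpt π hπ => by
      obtain ⟨π₀, hbot, -, -, hsat, N, hN, f, hf, hfW⟩ := hπ.exists_isNewform1_of_exists_fixed (hfix hcpt)
      refine ⟨N, hN, f, hf, fun v hvN => ?_⟩
      haveI : NeZero (natGenerator v) := neZero_natGenerator v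
      have hvN' : ¬ natGenerator v ∣ N := hvN
      have hv : ¬ v.asIdeal ∣ Ideal.span {(N : 𝓞 ℚ)} := fun h => hvN' ((Rat.natGenerator_dvd_iff v N).2 h)
      have hp : (natGenerator v).Prime := prime_natGenerator v
      have hT : EllipticCurves.ModularForms.heckeT (Gamma1 N) 1 (natGenerator v) f =
          cuspCoeff f (natGenerator v) • f := by
        have h := heckeT_eq_heckeEigenvalue_smul f (natGenerator v) (hf.2.1 _ hp)
        rw [IsNewform1.heckeEigenvalue_eq_coeff_holds hf hp] at h
        exact h
      have hD : diamondOp N 1 ((natGenerator v : ℕ) : ZMod N) f = nebentypus f ((natGenerator v : ℕ) : ZMod N) • f :=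
        hf.diamondOp_natCast_apply_of_not_dvd hp hvN'
      obtain ⟨α, hα, hpoly⟩ :=
        AutomorphicRepData.hasSatakeParamAt_of_adelicLiftFunA_mem hbot hf.ne_zero hfW hv hT hD
      refine ⟨α, hsat v α hα, ?_⟩
      rw [hpoly, map_heckePolynomial]
      have hpv : ((primesEquiv (R := 𝓞 ℚ) v : Nat.Primes) : ℕ) = natGenerator v := rfl
      rw [hpv, sub_self, zpow_zero, mul_one]
      rfl)

/-- **The same with the archimedean input as a parameter pair** (`hpair`: the Harish-Chandra
parameter of `π(σ)` at `∞` is `{s, s}`; Gelbart 1997, Prop. 4.1 at `∞`): `harch` follows by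
`IsPiOfArtinRep.isOfWeightOne_of_hasArchParameter_pair` (`StrongArtinCentralCharacter`: central
character `= det σ` of finite order, `s + s = 0`, and the sign of `σ`).
[cite: Gelbart1997, Prop. 4.2 and Prop. 4.1] [cite: DeligneSerreASENS1974, Thm. 4.1] -/
theorem exists_isNewform1_of_isPiOfArtinRep_of_pair_of_fixed
    (hDS : ∀ {N : ℕ} [NeZero N], exists_complexGaloisRep_of_weight_one (N := N))
    (hpair : ∀ (hcpt : isCompact_glFiniteIntegralLevel 2 ℚ)
      (σ : GaloisRepresentations.FramedArtinRep ℚ 2) (π : CuspidalAutomorphicRepData 2 ℚ hcpt),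
      σ.toGaloisRep.IsIrreducible → σ.IsOdd → IsPiOfArtinRep σ π.1 →
        ∃ s : ℂ, π.1.HasArchParameter fun _ => ({s, s} : Multiset ℂ))
    (hfix : ∀ (hcpt : isCompact_glFiniteIntegralLevel 2 ℚ) (π₀ : CuspidalAutomorphicRepData 2 ℚ hcpt),
      π₀.1.W' = ⊥ → π₀.1.IsOfWeightOne →
        (∀ φ ∈ π₀.1.W, ∀ z ∈ (AdelicGroupData.gl 2 ℚ).center', ∀ g, φ (z * g) = φ g) →
          ∃ (N : ℕ) (_ : NeZero N), ∃ φ ∈ π₀.1.W, φ ≠ 0 ∧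
            ∀ u ∈ gammaOneFiniteLevel ℚ (Ideal.span {(N : 𝓞 ℚ)}),
              rightTranslation (AdelicGroupData.gl 2 ℚ) (GLn.ofFinite 2 ℚ u) φ = φ) :
    exists_isNewform1_of_isPiOfArtinRep :=
  exists_isNewform1_of_isPiOfArtinRep_of_isOfWeightOne_of_fixed hDS
    (fun hcpt σ π hirr hodd hπ => by
      obtain ⟨s, hs⟩ := hpair hcpt σ π hirr hodd hπ
      exact hπ.isOfWeightOne_of_hasArchParameter_pair hodd hs)
    hfix

end Literature.NumberTheory.Automorphic

end
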